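import Summits.Ventures.Crystal3D.Theorems.StickyWulffConstantTextureLiminfTexShadowLevelLedgerEvents
import HarnessLib

/-!
# The level ledger in EVENT currency, II: launches from a STAR — the level-`k ≥ 2` form (polar launch from a twin reading into the far lamella)
# (lane T, crux `TextureLiminfV5`, stmt-Ventures-23912, registered stub `stub_terraceCensus`; 19480-p1 g19)

HONEST FRAMING. Venture `Summits/Ventures/Crystal3D` (cell `crystal3d-full`), route `route-Ventures-StickyWulffConstant`, helper `--supports` the
law-v5 crux `TextureLiminfV5` (stmt-Ventures-23912), lane T, line `TexShadow` v8.20, registered stub `stub_terraceCensus`, mechanism (β), LEDGER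
architecture (cf-p1 (ccxli)) in EVENT currency (…TexShadowLevelLedgerEvents, p734210).  CONDITIONAL on `P5Exhaustion` (`stub_E1`) BY NAME where
stated; poison-clean imports; finite geometry + counting; nothing about energies; F-C1 not moved.

THE POINT.  Part I launches lines at FULL balls (plate 1).  At level `k ≥ 2` the census launches at the READS of letter `k − 1`, which are twin
readings (lane F's `IsTwinReading X A n r`: own nine and the three mirror balls occupied, far slots empty), not full balls.  The trichotomy only
uses that the closed vertex star of `−δ₀` is occupied around the event ball, so:
* **`event_trichotomy_of_star`** — the trichotomy «pays (`≤ 11`) / glide-read / cross-read» from the star hypothesis alone (no full predecessor);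
* **`star_occupied_of_twinReading_mirrorLaunch`** — from a twin reading `r ∈ X` of `(A, n)` launch INTO the far lamella in the twin frame
  `A′ x = A x − 2⟪A x, n⟫ n` along a polar slot: the first ball is the mirror ball `r + A′ w` (`⟪A w, n⟫ < 0`), and the closed vertex star of `−w`
  (frame `A′`) around it is occupied — each star site is `r`, an in-plane own slot ball, or another mirror ball of the reading.  (An IN-PLANE launch
  from a reading carries only the hcp in-plane edge star — twistable, p731767 — and is deliberately not provided.)
* `chainEvent_mem_and_star` — the event of a line whose first ball carries the star is present, not full, has its predecessor present, and carries
  the star (it is the first ball, or its predecessor is full: `star_occupied_of_isFull_pred`);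
* **`card_le_card_starEvents_guarded`** — the injective windowed count for such launch sets (same guarded blocking as p732941); `launchStar_of_isFull`
  — full launch balls qualify, so Part I's count is the special case.
WHAT THIS IS NOT: the read bound, the choice of classes (of the three near-polar slots of a reading exactly one is polar to the next letter's plane as
well), or any energy statement; F-C1 not moved.
-/

noncomputable section

open scoped BigOperators InnerProductSpace

namespace Summit.Ventures.Crystal3D.Cruxes.TextureLiminf.TexShadow

open Finset Summit.Ventures.Crystal3D Summit.Ventures.Crystal3D.Theorems

variable (X : Finset (EuclideanSpace ℝ (Fin 3))) (A : EuclideanSpace ℝ (Fin 3) ≃ₗᵢ[ℝ] EuclideanSpace ℝ (Fin 3))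

/-! ## The trichotomy from the star hypothesis -/

/-- **EVENT TRICHOTOMY from the star hypothesis** (generalises `chainEvent_trichotomy`: the predecessor need not be full, only the closed vertex star of
`−δ₀` must be occupied around `x`).  Under `P5Exhaustion`: `x` pays (`≤ 11` contacts), or it has twelve and its shell is a twin dozen of `A` for a menu
normal `n` (own nine occupied, every contact an own slot ball or a mirror ball) with EITHER `⟪A δ₀, n⟫ = 0 ∧ x + A δ₀ ∈ X` (glide-read) OR
`⟪A δ₀, n⟫ = √(2/3) ∧ x + A δ₀ ∉ X` (cross-read). -/
theorem event_trichotomy_of_star (hE1 : P5Exhaustion) {X : Finset (EuclideanSpace ℝ (Fin 3))}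
    (hX : ∀ p ∈ X, ∀ q ∈ X, p ≠ q → 1 ≤ dist p q)
    {x δ₀ : EuclideanSpace ℝ (Fin 3)} (hδ₀ : δ₀ ∈ fccSlots) (hstar : ∀ w ∈ fccSlots, 0 < ⟪w, -δ₀⟫_ℝ → x + A w ∈ X)
    (hnot : ¬ IsFull X A x) :
    (X.filter fun q => dist x q = 1).card ≤ 11 ∨
      ((X.filter fun q => dist x q = 1).card = 12 ∧
        ∃ n : EuclideanSpace ℝ (Fin 3), IsMenuNormal A n ∧
          (∀ w ∈ fccSlots, ⟪A w, n⟫_ℝ ≤ 0 → x + A w ∈ X) ∧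
          (∀ q ∈ X, dist x q = 1 →
            (∃ w ∈ fccSlots, ⟪A w, n⟫_ℝ ≤ 0 ∧ q = x + A w) ∨
              ∃ w ∈ fccSlots, ⟪A w, n⟫_ℝ < 0 ∧ q = x + (A w - (2 * ⟪A w, n⟫_ℝ) • n)) ∧
          ((⟪A δ₀, n⟫_ℝ = 0 ∧ x + A δ₀ ∈ X) ∨ (⟪A δ₀, n⟫_ℝ = Real.sqrt (2 / 3) ∧ x + A δ₀ ∉ X))) := by
  classical
  set N := X.filter fun q => dist x q = 1 with hN
  have hle : N.card ≤ 12 := (isKissingAround_contacts X hX x).card_le_twelve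
  rcases Nat.lt_or_ge N.card 12 with hlt | hge
  · exact Or.inl (by omega)
  have h12 : N.card = 12 := le_antisymm hle hge
  right
  refine ⟨h12, ?_⟩
  have hpredX : x + A (-δ₀) ∈ X := hstar (-δ₀) (neg_mem_fccSlots hδ₀) (by
    rw [real_inner_self_eq_norm_sq, norm_neg, norm_eq_one_of_mem_fccSlots hδ₀]; norm_num)
  rcases shell_slots_or_twin_of_star_twelve hE1 A hX (neg_mem_fccSlots hδ₀) hstar h12 with hall | ⟨n, hmenu, hown, hcls⟩
  · exact absurd (isFull_of_contacts_subset_slots A hall h12) hnot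
  refine ⟨n, hmenu, hown, hcls, ?_⟩
  have s23 : (0 : ℝ) < Real.sqrt (2 / 3) := Real.sqrt_pos.2 (by norm_num)
  have hslot1 : ∀ {w}, w ∈ fccSlots → dist x (x + A w) = 1 := fun {w} hw => by
    rw [dist_eq_norm, sub_add_cancel_left, norm_neg, LinearIsometryEquiv.norm_map, norm_eq_one_of_mem_fccSlots hw]
  have own_of_contact : ∀ {u}, u ∈ fccSlots → x + A u ∈ X → ⟪A u, n⟫_ℝ ≤ 0 := by
    intro u hu huX
    rcases hcls _ huX (hslot1 hu) with ⟨w, hw, hle', hq⟩ | ⟨w, hw, hlt, hq⟩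
    · have : A u = A w := by simpa using hq
      rw [this]; exact hle'
    · have hwn : ⟪A w, n⟫_ℝ = -Real.sqrt (2 / 3) := by
        rcases hmenu.2 w hw with h | h | h
        · rw [h] at hlt; exact absurd hlt (lt_irrefl 0)
        · rw [h] at hlt; exact absurd hlt (not_lt.2 s23.le)
        · exact h
      have : A u = A w - (2 * ⟪A w, n⟫_ℝ) • n := by simpa using hq
      exact absurd this (slot_ne_mirrorSite A hu hw hwn)
  have hpredOwn : ⟪A (-δ₀), n⟫_ℝ ≤ 0 := own_of_contact (neg_mem_fccSlots hδ₀) hpredX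
  have hge0 : 0 ≤ ⟪A δ₀, n⟫_ℝ := by rw [map_neg, inner_neg_left] at hpredOwn; linarith
  rcases hmenu.2 δ₀ hδ₀ with h0 | hpos | hneg
  · exact Or.inl ⟨h0, hown δ₀ hδ₀ h0.le⟩
  · refine Or.inr ⟨hpos, fun hsucc => ?_⟩
    have := own_of_contact hδ₀ hsucc
    rw [hpos] at this
    exact absurd this (not_le.2 s23)
  · rw [hneg] at hge0
    exact absurd hge0 (not_le.2 (by linarith))

/-! ## The polar launch from a twin reading -/

/-- **POLAR LAUNCH FROM A TWIN READING.**  `r ∈ X` a twin reading of `(A, n)` (own nine and the three mirror balls occupied), `w` a slot on the near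
side (`⟪A w, n⟫ < 0`), `A′` the twin frame `x ↦ A x − 2⟪A x, n⟫ n`.  Around the mirror ball `r + A′ w` — the first ball of the line launched INTO the
far lamella in the frame `A′` along the polar slot `A′ w` — the closed vertex star of `−w` (frame `A′`) is occupied: each star site is `r`, an in-plane
own slot ball of `r`, or another mirror ball of `r`. -/
theorem star_occupied_of_twinReading_mirrorLaunch {X : Finset (EuclideanSpace ℝ (Fin 3))}
    (A' : EuclideanSpace ℝ (Fin 3) ≃ₗᵢ[ℝ] EuclideanSpace ℝ (Fin 3)) {n r w : EuclideanSpace ℝ (Fin 3)} (hrX : r ∈ X)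
    (hr : IsTwinReading X A n r) (hw : w ∈ fccSlots) (hwn : ⟪A w, n⟫_ℝ < 0) (hA' : ∀ x, A' x = A x - (2 * ⟪A x, n⟫_ℝ) • n) :
    ∀ v ∈ fccSlots, 0 < ⟪v, -w⟫_ℝ → (r + A' w) + A' v ∈ X := by
  obtain ⟨hmenu, hown, hmirror, -⟩ := hr
  have s23 : (0 : ℝ) < Real.sqrt (2 / 3) := Real.sqrt_pos.2 (by norm_num)
  have hwn' : ⟪A w, n⟫_ℝ = -Real.sqrt (2 / 3) := by
    rcases hmenu.2 w hw with h | h | h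
    · rw [h] at hwn; exact absurd hwn (lt_irrefl 0)
    · rw [h] at hwn; exact absurd hwn (not_lt.2 s23.le)
    · exact h
  intro v hv hpos
  have hneg : ⟪v, w⟫_ℝ < 0 := by rw [inner_neg_right] at hpos; linarith
  rcases eq_neg_or_add_mem_fccSlots_of_inner_neg hw hv hneg with rfl | hs
  · -- the apex: `r` itself
    rw [map_neg, add_neg_cancel_right]; exact hrX
  · have e : r + A' w + A' v = r + A' (w + v) := by rw [map_add, add_assoc]
    rw [e]
    rcases hmenu.2 (w + v) hs with h0 | hp | hm
    · -- in-plane: `A′(w+v) = A(w+v)`, an own slot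
      have : A' (w + v) = A (w + v) := by rw [hA', h0]; simp
      rw [this]; exact hown _ hs h0.le
    · -- `⟪A(w+v), n⟫ = +√(2/3)` is impossible: `⟪A(w+v), n⟫ = ⟪A w, n⟫ + ⟪A v, n⟫ ≤ −√(2/3) + √(2/3) = 0`
      exfalso
      have hsum : ⟪A (w + v), n⟫_ℝ = ⟪A w, n⟫_ℝ + ⟪A v, n⟫_ℝ := by rw [map_add, inner_add_left]
      have hvle : ⟪A v, n⟫_ℝ ≤ Real.sqrt (2 / 3) := by
        rcases hmenu.2 v hv with h | h | h <;> rw [h] <;> linarith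
      rw [hsum, hwn'] at hp
      linarith
    · -- near-polar: `A′(w+v)` is the mirror site of the slot `w + v`
      have : A' (w + v) = A (w + v) - (2 * ⟪A (w + v), n⟫_ℝ) • n := hA' _
      rw [this]
      exact hmirror _ hs (by rw [hm]; linarith)

/-! ## The event of a star launch, and the count -/

open scoped Classical in
/-- **The event of a line whose FIRST ball carries the star**: present, not full, predecessor present, and the closed vertex star of `−δ₀` occupied
around it (either it is the first ball, or its predecessor is full). -/
theorem chainEvent_mem_and_star {δ₀ : EuclideanSpace ℝ (Fin 3)} (hδ₀ : δ₀ ∈ fccSlots) {b : EuclideanSpace ℝ (Fin 3)} (hb : b ∈ X)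
    (hbc : b + A δ₀ ∈ X) (hstar : ∀ v ∈ fccSlots, 0 < ⟪v, -δ₀⟫_ℝ → b + A δ₀ + A v ∈ X) :
    chainEvent X A (map_slot_ne_zero A hδ₀) b ∈ X ∧ ¬ IsFull X A (chainEvent X A (map_slot_ne_zero A hδ₀) b) ∧
      chainEvent X A (map_slot_ne_zero A hδ₀) b - A δ₀ ∈ X ∧
      ∀ v ∈ fccSlots, 0 < ⟪v, -δ₀⟫_ℝ → chainEvent X A (map_slot_ne_zero A hδ₀) b + A v ∈ X := by
  have hc : A δ₀ ≠ 0 := map_slot_ne_zero A hδ₀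
  have main : chainEvent X A hc b ∈ X ∧ chainEvent X A hc b - A δ₀ ∈ X ∧
      ∀ v ∈ fccSlots, 0 < ⟪v, -δ₀⟫_ℝ → chainEvent X A hc b + A v ∈ X := by
    rcases Nat.eq_zero_or_pos (chainEventSteps X A hc b) with h0 | hpos
    · have e : chainEvent X A hc b = b + A δ₀ := by
        rw [chainEvent, h0]; simp
      rw [e, add_sub_cancel_right]
      exact ⟨hbc, hb, hstar⟩
    · obtain ⟨i, hi⟩ : ∃ i, chainEventSteps X A hc b = i + 1 := ⟨chainEventSteps X A hc b - 1, by omega⟩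
      have h := mem_and_isFull_of_lt_chainEventSteps X A hc b (j := i) (by omega)
      have epred : chainEvent X A hc b - A δ₀ = b + ((i + 1 : ℕ) : ℝ) • A δ₀ := by rw [chainEvent_sub, hi]
      have hpX : chainEvent X A hc b - A δ₀ ∈ X := by rw [epred]; exact h.1
      have hpF : IsFull X A (chainEvent X A hc b - A δ₀) := by rw [epred]; exact h.2
      refine ⟨?_, hpX, star_occupied_of_isFull_pred A hδ₀ hpX hpF⟩
      have := hpF δ₀ hδ₀
      rwa [sub_add_cancel] at this
  refine ⟨main.1, ?_, main.2.1, main.2.2⟩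
  rcases chainEvent_spec X A hc b with h | h
  · exact absurd main.1 h
  · exact h

open scoped Classical in
/-- **THE INJECTIVE WINDOWED COUNT for star launches (guarded blocking)** — the level-`k ≥ 2` form: `S` a launch set for `c = A δ₀` (`0 ≤ c₂`) such
that around the first ball `b + c` of every launched line the closed vertex star of `−δ₀` is occupied (`star_occupied_of_twinReading_mirrorLaunch`, or
`launchStar_of_isFull` for full launch balls).  Then `#S ≤ #`{`x ∈ X` not full, `x − c ∈ X`, star of `−δ₀` occupied around `x`, `zlo ≤ x₂`, and
`x₂ ≤ zhi + c₂` or predecessor outside the guard} — and `event_trichotomy_of_star` applies to every element of that set. -/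
theorem card_le_card_starEvents_guarded {δ₀ : EuclideanSpace ℝ (Fin 3)} (hδ₀ : δ₀ ∈ fccSlots) (hc2 : 0 ≤ (A δ₀) 2)
    {S : Finset (EuclideanSpace ℝ (Fin 3))} (hS : IsLaunchSet X (A δ₀) S)
    (hSstar : ∀ b ∈ S, ∀ v ∈ fccSlots, 0 < ⟪v, -δ₀⟫_ℝ → b + A δ₀ + A v ∈ X)
    {zlo zhi : ℝ} (hzlo : ∀ b ∈ S, zlo ≤ b 2)
    (G : EuclideanSpace ℝ (Fin 3) → Prop) (hblock : ∀ e ∈ X, G e → zhi < e 2 → e + A δ₀ ∉ X) :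
    S.card ≤ (X.filter fun x => ¬ IsFull X A x ∧ x - A δ₀ ∈ X ∧ (∀ v ∈ fccSlots, 0 < ⟪v, -δ₀⟫_ℝ → x + A v ∈ X) ∧ zlo ≤ x 2 ∧
      (x 2 ≤ zhi + (A δ₀) 2 ∨ ¬ G (x - A δ₀))).card := by
  set c := A δ₀ with hcdef
  have hc : c ≠ 0 := map_slot_ne_zero A hδ₀
  refine Finset.card_le_card_of_injOn (chainEvent X A hc) (fun b hb => ?_) (chainEvent_injOn X A hc hS)
  have hbX : b ∈ X := hS.1 hb
  obtain ⟨hxX, hnot, hpX, hst⟩ := chainEvent_mem_and_star X A hδ₀ hbX (hS.2.1 b hb) (hSstar b hb)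
  refine mem_coe.2 (mem_filter.2 ⟨hxX, hnot, hpX, hst, ?_, ?_⟩)
  · have : (chainEvent X A hc b) 2 = b 2 + ((chainEventSteps X A hc b : ℝ) + 1) * c 2 := by
      simp [chainEvent]
    rw [this]
    nlinarith [Nat.cast_nonneg (α := ℝ) (chainEventSteps X A hc b), hzlo b hb]
  · by_cases hG : G (chainEvent X A hc b - c)
    · left
      have hle : (chainEvent X A hc b - c) 2 ≤ zhi := by
        by_contra hlt
        push Not at hlt
        have := hblock _ hpX hG hlt
        rw [sub_add_cancel] at this
        exact this hxX
      have e : (chainEvent X A hc b - c) 2 = (chainEvent X A hc b) 2 - c 2 := by simp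
      linarith [e ▸ hle]
    · right; exact hG

/-- Full launch balls satisfy the star hypothesis of `card_le_card_starEvents_guarded` (so Part I's count is the special case). -/
theorem launchStar_of_isFull {X : Finset (EuclideanSpace ℝ (Fin 3))} {δ₀ : EuclideanSpace ℝ (Fin 3)} (hδ₀ : δ₀ ∈ fccSlots)
    {b : EuclideanSpace ℝ (Fin 3)} (hb : b ∈ X) (hfull : IsFull X A b) :
    ∀ v ∈ fccSlots, 0 < ⟪v, -δ₀⟫_ℝ → b + A δ₀ + A v ∈ X :=
  star_occupied_of_isFull_pred A hδ₀ (by rw [add_sub_cancel_right]; exact hb) (by rw [add_sub_cancel_right]; exact hfull)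

open scoped Classical in
/-- **Star events PAY or READ** (packaging for `sum_deficiency_ge_card_sub_card_reads`): every element of the event set of
`card_le_card_starEvents_guarded` with twelve contacts is a glide- or cross-reading of the frame along `A δ₀`. -/
theorem starEvents_reads_are_twinReadings (hE1 : P5Exhaustion) (hX : ∀ p ∈ X, ∀ q ∈ X, p ≠ q → 1 ≤ dist p q)
    {δ₀ : EuclideanSpace ℝ (Fin 3)} (hδ₀ : δ₀ ∈ fccSlots) (W : EuclideanSpace ℝ (Fin 3) → Prop) :
    ∀ x ∈ (X.filter fun x => ¬ IsFull X A x ∧ x - A δ₀ ∈ X ∧ (∀ v ∈ fccSlots, 0 < ⟪v, -δ₀⟫_ℝ → x + A v ∈ X) ∧ W x),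
      (X.filter fun q => dist x q = 1).card = 12 →
        ∃ n : EuclideanSpace ℝ (Fin 3), IsMenuNormal A n ∧
          (∀ w ∈ fccSlots, ⟪A w, n⟫_ℝ ≤ 0 → x + A w ∈ X) ∧
          ((⟪A δ₀, n⟫_ℝ = 0 ∧ x + A δ₀ ∈ X) ∨ (⟪A δ₀, n⟫_ℝ = Real.sqrt (2 / 3) ∧ x + A δ₀ ∉ X)) := by
  intro x hx h12
  obtain ⟨-, hnot, -, hst, -⟩ := mem_filter.1 hx
  rcases event_trichotomy_of_star A hE1 hX hδ₀ hst hnot with h | ⟨-, n, hmenu, hown, -, hcases⟩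
  · omega
  · exact ⟨n, hmenu, hown, hcases⟩

end Summit.Ventures.Crystal3D.Cruxes.TextureLiminf.TexShadow

end
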